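import Summits.ResolutionOfSingularities.ResolutionOfSingularities.Theorems.FrobeniusLadderFInjectiveMacaulayficationOfLocalDoorAdm
import Summits.ResolutionOfSingularities.ResolutionOfSingularities.Theorems.FrobeniusLadderFInjectiveMacaulayficationClosedPointLocalResolutionAdmTr
import Summits.ResolutionOfSingularities.ResolutionOfSingularities.Theorems.FrobeniusLadderFInjectiveMacaulayficationOfCesnaviciusFact
import HarnessLib

/-!
# THE ROUTE DECL FROM THE TRANSCENDENTAL-FIELD RUNGS: `FInjectiveMacaulayfication` ⟸ {CP 1.1, R–G 081R, CP 4.4} ∧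
# {`ClosedPointLocalResolutionAdmTr p e r` : p prime, e ≥ 4, r ≥ 1} ∧ (LF_adm) — door v36.2 with its resolution-side stub UNFOLDED into the
# closed-point ladder (crux `FInjectiveMacaulayfication` stmt-ResolutionOfSingularities-15315, chain w45a; seat res-L1-w45a-stub-3 g8)

[OURS · L1 W4.5a] Support file (`--supports stmt-ResolutionOfSingularities-15315 --as helper`); replaces the role of NO printed item; NOT a statement of any
manuscript; def-free; one-line compositions of res-L1-w45a-stub-1's `OfLocalDoorAdm.fInjectiveMacaulayfication_of_localDoorAdm[_of_fact]` (p591893 / p594133)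
with this seat's `ClosedPointLocalResolutionAdmTr.localResolutionNonClosedGe4Adm_of_tr` (p602502). NOT a registration and NOT a replacement of the door's
stub (res-L1-w45a-plan-1 CRUX-PLAN v31.1 §B: the rung is an attack object); it records in the kernel that the d-UNIFORM door's resolution-side input
is EXACTLY «closed-point admissible local resolution of e-folds over k(X₁,…,X_r), every e ≥ 4, every r ≥ 1» (perfect ground fields never consumed).
AI-written (AI review is weaker than expert review).

* `fInjectiveMacaulayfication_of_trRungs (hG h081R hP) (hR) (hLF : LocalFullificationFibreAdmGe4) : Theses.FrobeniusLadder.FInjectiveMacaulayfication`;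
* `fInjectiveMacaulayfication_of_trRungs_of_fact (hG h081R hP) (hM : Česnavičius binder) (hR) (hF : LocalFInjectivizationFibreAdmGe4) : …` (v37 shape).

[folklore assembly; cite: Temkin2008, Prop. 2.3.4 (iii); CossartPiltant2019, Thm. 1.1 (i)(ii) and Prop. 4.4; RaynaudGruson1971, Thm. 5.2.2; Cesnavicius2021, Thm. 5.3]
-/

-- single-problem summit: the doubled namespace component is forced
set_option linter.dupNamespace false

noncomputable section

namespace Summit.ResolutionOfSingularities.ResolutionOfSingularities.Theorems.FInjectiveMacaulayfication.OfTrRungs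

open CategoryTheory AlgebraicGeometry TopologicalSpace IsLocalRing
open Literature.AlgebraicGeometry.Resolution
open Summit.ResolutionOfSingularities.ResolutionOfSingularities.Theorems.FInjectiveMacaulayfication
open ClosedPointLocalResolutionAdmTr

/-- **★ THE ROUTE DECL ⟸ {CP 1.1, 081R, CP 4.4} ∧ the transcendental-field rungs (all `e ≥ 4`, `r ≥ 1`) ∧ (LF_adm).** [OURS · conditional-result]
[cite: CossartPiltant2019, Thm. 1.1 (i)(ii); Prop. 4.4] [cite: RaynaudGruson1971, Thm. 5.2.2] [cite: Temkin2008, Prop. 2.3.4 (iii)] -/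
theorem fInjectiveMacaulayfication_of_trRungs
    (hG : CossartPiltant2019General.{0}) (h081R : Stacks081R.{0}) (hP : CossartPiltant2019Principalization.{0})
    (hR : ∀ p e r : ℕ, p.Prime → 4 ≤ e → 1 ≤ r → ClosedPointLocalResolutionAdmTr p e r)
    (hLF : LocalFullificationFibreAdmGe4.LocalFullificationFibreAdmGe4) :
    Summit.ResolutionOfSingularities.ResolutionOfSingularities.Theses.FrobeniusLadder.FInjectiveMacaulayfication :=
  OfLocalDoorAdm.fInjectiveMacaulayfication_of_localDoorAdm hG h081R hP (localResolutionNonClosedGe4Adm_of_tr hR) hLF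

/-- **★ THE ROUTE DECL ⟸ {CP 1.1, 081R, CP 4.4} ∧ [Česnavičius 2021 Thm. 5.3 as the binder `hM`] ∧ the transcendental-field rungs ∧ the F-half (LF_adm-F)**
— door v37's shape with the resolution stub unfolded into the ladder. [OURS · conditional-result: conditional on the Česnavičius text AS TYPED in `hM` and
on the CANDIDATE statements] [cite: Cesnavicius2021, Thm. 5.3] [cite: CossartPiltant2019, Thm. 1.1 (i)(ii); Prop. 4.4] [cite: Temkin2008, Prop. 2.3.4 (iii)] -/
theorem fInjectiveMacaulayfication_of_trRungs_of_fact
    (hG : CossartPiltant2019General.{0}) (h081R : Stacks081R.{0}) (hP : CossartPiltant2019Principalization.{0})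
    (hM : ∀ (Y : Scheme.{0}) [IsIntegral Y] [IsNoetherian Y], Scheme.IsExcellent Y →
      ∃ Z : Y.IdealSheafData,
        (∀ y : Y, y ∈ (Z.support : Set Y) →
          ¬ (∀ d : ℕ, ringKrullDim (Y.presheaf.stalk y) = d →
              ∀ s : Fin d → Y.presheaf.stalk y, (Ideal.span (Set.range s)).radical.IsMaximal →
                RingTheory.Sequence.IsWeaklyRegular (Y.presheaf.stalk y) (List.ofFn s))) ∧
        ∀ (Y' : Scheme.{0}) (π : Y' ⟶ Y), IsBlowup π Z →
          ∀ y' : Y', ∀ d : ℕ, ringKrullDim (Y'.presheaf.stalk y') = d →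
            ∀ s : Fin d → Y'.presheaf.stalk y', (Ideal.span (Set.range s)).radical.IsMaximal →
              RingTheory.Sequence.IsWeaklyRegular (Y'.presheaf.stalk y') (List.ofFn s))
    (hR : ∀ p e r : ℕ, p.Prime → 4 ≤ e → 1 ≤ r → ClosedPointLocalResolutionAdmTr p e r)
    (hF : LocalFullificationFibreAdmGe4Split.LocalFInjectivizationFibreAdmGe4) :
    Summit.ResolutionOfSingularities.ResolutionOfSingularities.Theses.FrobeniusLadder.FInjectiveMacaulayfication :=
  OfLocalDoorAdm.fInjectiveMacaulayfication_of_localDoorAdm_of_fact hG h081R hP hM (localResolutionNonClosedGe4Adm_of_tr hR) hF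

/-! ## §2 BY NAME with the Česnavičius Literature fact (door v37's fourth named fact; appended after DR-CZ3 «ADMITTED», p602953) — the `_proof` term a
CLOSED-POINT-LANGUAGE door {namedFacts(4), CPLRA-Tr (`e ≥ 4`, `r ≥ 1`), F-half} would use (res-L1-w45a-lead-1 03:50:22Z / R17.13; the residue is
EQUIVALENT to v37's by `LRadmIffTr.localResolutionNonClosedGe4Adm_iff_tr`, p604770). Seat res-L1-w45a-stub-3 g8. -/

/-- **★ THE ROUTE DECL ⟸ {CP 1.1, 081R, CP 4.4, Česnavičius 2021 Thm. 5.3 — reading (B), BY NAME} ∧ the transcendental-field rungs (all `e ≥ 4`, `r ≥ 1`)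
∧ the F-half (LF_adm-F).** One line over res-L1-w45a-stub-2's `OfLocalDoorAdmFactOffClosed.fInjectiveMacaulayfication_of_localDoorAdm_of_factOffClosed`
(door v37's `_proof` term) and `localResolutionNonClosedGe4Adm_of_tr`. [OURS · conditional-result: conditional on four published theorems BY NAME and on the
CANDIDATE rungs / F-half] [cite: Cesnavicius2021, Thm. 5.3] [cite: CossartPiltant2019, Thm. 1.1 (i)(ii); Prop. 4.4] [cite: RaynaudGruson1971, Thm. 5.2.2]
[cite: Temkin2008, Prop. 2.3.4 (iii)] -/
theorem fInjectiveMacaulayfication_of_trRungs_of_cesnaviciusOffClosed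
    (hG : CossartPiltant2019General.{0}) (h081R : Stacks081R.{0}) (hP : CossartPiltant2019Principalization.{0})
    (hM : CesnaviciusBlowupMacaulayficationOffClosed.{0})
    (hR : ∀ p e r : ℕ, p.Prime → 4 ≤ e → 1 ≤ r → ClosedPointLocalResolutionAdmTr p e r)
    (hF : LocalFullificationFibreAdmGe4Split.LocalFInjectivizationFibreAdmGe4) :
    Summit.ResolutionOfSingularities.ResolutionOfSingularities.Theses.FrobeniusLadder.FInjectiveMacaulayfication :=
  OfLocalDoorAdmFactOffClosed.fInjectiveMacaulayfication_of_localDoorAdm_of_factOffClosed hG h081R hP hM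
    (localResolutionNonClosedGe4Adm_of_tr hR) hF

/-- The same with reading (A) BY NAME (`CesnaviciusBlowupMacaulayfication`), through `OfCesnaviciusFact.cesnaviciusOffClosed_of_cesnavicius`.
[OURS · conditional-result] [cite: Cesnavicius2021, Thm. 5.3] [cite: CossartPiltant2019, Thm. 1.1 (i)(ii); Prop. 4.4] [cite: Temkin2008, Prop. 2.3.4 (iii)] -/
theorem fInjectiveMacaulayfication_of_trRungs_of_cesnavicius
    (hG : CossartPiltant2019General.{0}) (h081R : Stacks081R.{0}) (hP : CossartPiltant2019Principalization.{0})
    (hM : CesnaviciusBlowupMacaulayfication.{0})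
    (hR : ∀ p e r : ℕ, p.Prime → 4 ≤ e → 1 ≤ r → ClosedPointLocalResolutionAdmTr p e r)
    (hF : LocalFullificationFibreAdmGe4Split.LocalFInjectivizationFibreAdmGe4) :
    Summit.ResolutionOfSingularities.ResolutionOfSingularities.Theses.FrobeniusLadder.FInjectiveMacaulayfication :=
  fInjectiveMacaulayfication_of_trRungs_of_cesnaviciusOffClosed hG h081R hP (OfCesnaviciusFact.cesnaviciusOffClosed_of_cesnavicius hM) hR hF

end Summit.ResolutionOfSingularities.ResolutionOfSingularities.Theorems.FInjectiveMacaulayfication.OfTrRungs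

end
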